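/-
Copyright (c) 2026 the pub-hodgecm-mathlib formalisation cell (harness21).  Prover seat hodgecm-mathlib-K2Liu-p23 (g4), Track B «K2-LIT»,
#184♮ = hLiu418 = `stmt-HodgeConjecture-24832`; K1-a♮ `hGnb` road, FILE C ED. 3 — PART 1 (K1a desk WORDS #16∕#28∕#39 «T₀-SPLIT», hGnb desk WORD #1, 2026-09-05):
THE σ-UNIFORM LOCAL FACE OF A MONOMIAL-FLAT FAMILY AT ONE (BAD) PLACE — pieces σ-free, one growth exponent per `z` for ALL corner entries `σ`.
KERNEL: theorems only (no `def`, no `instance`, no notation, no named-fact hypothesis, no `sorry`); lane `--supports stmt-HodgeConjecture-24832 --as helper`.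
-/
import Summits.HodgeConjecture.HodgeConjecture.Theorems.K2LiuKindOneSingularLocalFaceMonomialGrowth    -- ★ FILE B ED.2 p865228 (LH4-p07 (g12)): §1 `norm_sum_mul_le`, `norm_cpow_two_mul`, `exists_uniform_pow_bound`; brings ★ FILE B ED.1 + ★ p863501
import HarnessLib

/-!
# Crux `HLiu418`, socket #41, KIND 1 a♮ — FILE C ED. 3, PART 1: THE σ-UNIFORM LOCAL FACE OF A MONOMIAL-FLAT FAMILY AT ONE PLACE

Cell `hodgecm-mathlib`, crux item hLiu418 = `stmt-HodgeConjecture-24832` (helper lane `--supports … --as helper`, count-neutral), route of record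
`HCCMUnconditional`; squad K2 ∕ K2Liu, socket #41, KIND 1, block K1-a♮ (`hGnb` ← `hGnv` road); K1a desks K2Liu-p01 (g11) → K2E4-p10 (g11), hGnb desk K2Liu-p23 (g4).
Consumer: PART 2 `K2LiuKindOneSingularLocalFaceOfRecordEdThree.locFace_letters_of_record₃` (the T₀-SPLIT assembly of ★ p864641's `hGnv`).

THE POINT.  ★ FILE B ED.2 `exists_localFace_kindOneSingular_monomial_growth` (p865228) takes the corner entry `σ` as a BINDER and hides its pieces `(S, Fc, Gn₀)` in an
existential UNDER that binder; the growth letter `hGnv` (★ p864641 :126–:131) wants ONE exponent for ALL rank-one indices `S` (i.e. all `σ = σc S`), so the consumer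
needs the pieces σ-FREE and the per-piece faces as a FAMILY IN `σ`.  THIS FILE re-assembles ★ FILE B ED.1 `exists_monomialFlat_pieces` (σ-free: labels `c` with
`c² ∈ q_v^ℤ`, pieces `F_c` `K₀`-flat smooth Siegel) with ★ p863501 `exists_localFace_kindOneSingular` applied per `(c, σ)`, and a WITNESS-FREE per-place growth letter
`hgrowth` (for every `K₀`-flat family `F`: «∀ z, ∃ M r, ∀ σ, ∀ Gn with ★ p863501's clauses (G1)(G2) for `(F, σ)`, ‖Gn s (pt x)‖ ≤ (Bnd σ x)^M on `dist s z < r`» — the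
(P-bad) letter of the T₀-split, over an ABSTRACT translate type `X`, point map `pt`, and base `Bnd ≥ q_v`), into: a σ-indexed face `GnF σ = Σ_c c^{2(s−s₀)}·Gn₀ c σ` with
(G1)(G2) for the monomial-flat `G` at every admissible `σ`, and ONE exponent `E z := #S + M_ℓ(z) + max_c M_c(z)` and ONE radius `ρ z > 0` per `z`, σ-free
(labels' monomials `c^{2re(s−s₀)} ≤ q_v^{M_ℓ}` by ★ FILE B ED.2 §1 `exists_uniform_pow_bound`; `#S ≤ Bnd^{#S}` since `Bnd ≥ q_v ≥ 2`).
* §1 generic bookkeeping (a positive real `≤ 1` below finitely many positive reals; `Σ_{i∈s} g i ≤ B^{#s+N}`; `q^a·B^b ≤ B^{a+b}`);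
* §2 HEAD **`exists_face_sigmaUniform_of_monomialFlat`**.
[KudlaRallis1994, §2], [KudlaSweet1997, §1], [HarrisKudlaSweet1996, §1 (1.15), §6 (6.14)–(6.16)], [Casselman1980, §3 Thm. 3.1], [Shimura1997, §18.1 (18.4)].

HONEST LABEL.  Count-neutral helper; it closes no socket by itself: `HC_CM` is proved only modulo the 7 printed citations (2 remaining named inputs: hLiu418 =
`stmt-HodgeConjecture-24832`, h413 = `stmt-HodgeConjecture-24833`) until rung 0 closes.  The growth letter `hgrowth` stays BY VALUE (payer: the ball-letters road
U-0∕U-1∕U-2∕(α) of LH4-p07 (g12) + ★ p864748's algebra, per place).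

## References
* [KudlaRallis1994] S. Kudla, S. Rallis, *A regularized Siegel–Weil formula: the first term identity*, Ann. of Math. 140 (1994): §2.
* [KudlaSweet1997] S. Kudla, W. J. Sweet, *Degenerate principal series representations for U(n,n)*, Israel J. Math. 98 (1997): §1.
* [HarrisKudlaSweet1996] M. Harris, S. Kudla, W. J. Sweet, J. AMS 9 (1996): §1 (1.15), §6 (6.14)–(6.16).
* [Casselman1980] W. Casselman, *The unramified principal series of p-adic groups I*, Compositio Math. 40 (1980): §3 Thm. 3.1.
* [Shimura1997] G. Shimura, *Euler products and Eisenstein series*, CBMS 93 (1997): §18.1 (18.4).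
-/

set_option autoImplicit false
-- the mandated namespace repeats the single-problem summit's segment (`HodgeConjecture.HodgeConjecture`)
set_option linter.dupNamespace false

open scoped NNReal ENNReal ComplexConjugate
open NumberField IsDedekindDomain MeasureTheory Topology
open Literature.NumberTheory.GaloisRepresentations.IsNonarchimedeanLocalField
open Literature.NumberTheory.Automorphic Literature.NumberTheory.Automorphic.UnitaryGroup Literature.NumberTheory.GaloisRepresentations
open Literature.NumberTheory.GelbartRogawski1991 Literature.NumberTheory.GelbartRogawski1991.GRConstruction
open Literature.NumberTheory.GelbartRogawski1991.UnitaryDualPair Literature.NumberTheory.GelbartRogawski1991.UnitaryDualPair.LocalSplitting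
open Literature.NumberTheory.K2Lit Literature.NumberTheory.K2Lit.SiegelDoubled Literature.NumberTheory.K2Lit.LocalSiegelDoubled
open Summit.HodgeConjecture.HodgeConjecture.Cruxes.HLiu418.K2LiuQRationalDefs
open Summit.HodgeConjecture.HodgeConjecture.Cruxes.HLiu418.K2LiuFlatSiegelFamilies (isQRationalRegularAt_zpow_cpow_add)
open Summit.HodgeConjecture.HodgeConjecture.Cruxes.HLiu418.K2LiuSiegelUnipotentLocalDefs (unipDeltaLoc)
open Summit.HodgeConjecture.HodgeConjecture.Cruxes.HLiu418.K2LiuSiegelUnipotentFourierDefs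
open Summit.HodgeConjecture.HodgeConjecture.Cruxes.HLiu418.K2LiuSiegelUnipotentCharacters
open Summit.HodgeConjecture.HodgeConjecture.Cruxes.HLiu418.K2LiuKindOneSingularLocalFace (exists_localFace_kindOneSingular)
open Summit.HodgeConjecture.HodgeConjecture.Cruxes.HLiu418.K2LiuKindOneSingularLocalFaceMonomial
  (exists_monomialFlat_pieces integral_mul_eq_sum integrable_conj_unipDeltaChar_mul cpow_two_mul_of_pos)
open Summit.HodgeConjecture.HodgeConjecture.Cruxes.HLiu418.K2LiuKindOneSingularLocalFaceMonomialGrowth (norm_sum_mul_le norm_cpow_two_mul exists_uniform_pow_bound)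

namespace Summit.HodgeConjecture.HodgeConjecture.Cruxes.HLiu418.K2LiuKindOneSingularLocalFaceSigmaUniform

/-! ## §1 Generic bookkeeping -/

section Generic

/-- a positive real `≤ 1` below finitely many positive reals. [folklore] -/
theorem exists_pos_le_one_forall_le {ι : Type*} (s : Finset ι) (f : ι → ℝ) (hf : ∀ i ∈ s, 0 < f i) :
    ∃ r : ℝ, 0 < r ∧ r ≤ 1 ∧ ∀ i ∈ s, r ≤ f i := by
  classical
  induction s using Finset.induction_on with
  | empty => exact ⟨1, one_pos, le_rfl, fun i hi => absurd hi (Finset.notMem_empty i)⟩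
  | @insert a s ha ih =>
    obtain ⟨r, hr, hr1, hrs⟩ := ih fun i hi => hf i (Finset.mem_insert_of_mem hi)
    refine ⟨min r (f a), lt_min hr (hf a (Finset.mem_insert_self a s)), (min_le_left _ _).trans hr1, fun i hi => ?_⟩
    rcases Finset.mem_insert.1 hi with rfl | hi
    · exact min_le_right _ _
    · exact (min_le_left _ _).trans (hrs i hi)

/-- **finite sums against one base**: if `g i ≤ B ^ N` on `s` and `2 ≤ B` then `Σ_{i ∈ s} g i ≤ B ^ (#s + N)` (`#s ≤ 2^{#s} ≤ B^{#s}`). [folklore] -/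
theorem sum_le_pow_card_add {ι : Type*} (s : Finset ι) {B : ℝ} (hB : 2 ≤ B) (g : ι → ℝ) (N : ℕ) (hg : ∀ i ∈ s, g i ≤ B ^ N) :
    ∑ i ∈ s, g i ≤ B ^ (s.card + N) := by
  have hB0 : 0 ≤ B := zero_le_two.trans hB
  have hcard : (s.card : ℝ) ≤ B ^ s.card :=
    calc (s.card : ℝ) ≤ ((2 ^ s.card : ℕ) : ℝ) := by exact_mod_cast s.card.lt_two_pow_self.le
      _ = (2 : ℝ) ^ s.card := by push_cast; ring
      _ ≤ B ^ s.card := pow_le_pow_left₀ zero_le_two hB _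
  calc ∑ i ∈ s, g i ≤ ∑ _i ∈ s, B ^ N := Finset.sum_le_sum hg
    _ = (s.card : ℝ) * B ^ N := by rw [Finset.sum_const, nsmul_eq_mul]
    _ ≤ B ^ s.card * B ^ N := mul_le_mul_of_nonneg_right hcard (pow_nonneg hB0 _)
    _ = B ^ (s.card + N) := by rw [pow_add]

/-- `q ^ a * B ^ b ≤ B ^ (a + b)` when `0 ≤ q ≤ B`. [folklore] -/
theorem pow_mul_pow_le_pow_add {q B : ℝ} (hq : 0 ≤ q) (hqB : q ≤ B) (a b : ℕ) : q ^ a * B ^ b ≤ B ^ (a + b) := by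
  rw [pow_add]
  exact mul_le_mul_of_nonneg_right (pow_le_pow_left₀ hq hqB a) (pow_nonneg (hq.trans hqB) _)

end Generic

/-! ## §2 HEAD: the σ-uniform local face of a monomial-flat family at one place -/

section CM

variable (L : Type) [Field L] [NumberField L] [IsCMField L] {N M : ℕ} (e : Fin N × Fin M ≃ Fin 2)
  (dV : Fin N → L) (hdV : ∀ i, IsCMField.complexConj L (dV i) = dV i) (hdV0 : ∀ i, dV i ≠ 0)
  (dW : Fin M → L) (hdW : ∀ i, IsCMField.complexConj L (dW i) = dW i) (hdW0 : ∀ i, dW i ≠ 0)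
  (v : HeightOneSpectrum (𝓞 (Fp L)))

set_option maxHeartbeats 1600000 in -- ★ FILE B ED.1's MEASURED class (`exists_monomialFlat_pieces` 1.6M: the `localPi (F := Fp L)` telescope contacts) + ★ p863501 per (piece, σ)
include hdV0 hdW0 in
/-- **THE σ-UNIFORM LOCAL FACE OF A MONOMIAL-FLAT FAMILY AT ONE PLACE.**  Binders: ★ FILE B ED.2's VERBATIM up to `hG` (compact open Iwasawa `K₀`, the monomial-flat
family `G` with its height letters (f1)(f2ᴷ)(f3)(f4) and reading `hG`), then an ABSTRACT translate type `X` with point map `pt : X → H_v` and base `Bnd : L → X → ℝ` with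
`q_v ≤ Bnd σ x`, and the WITNESS-FREE per-place growth letter `hgrowth` (for every `K₀`-flat family `F` of smooth Siegel sections of weight `χ_v`: ∀ z, 0 < re z → ∃ M r,
0 < r ∧ ∀ σ admissible, ∀ Gn with ★ p863501's (G1)(G2) for `(F, σ)`, ∀ s, dist s z < r → ∀ x, ‖Gn s (pt x)‖ ≤ (Bnd σ x)^M).  Conclusion: a σ-INDEXED face `GnF`, ONE
exponent `E : ℂ → ℕ` and ONE radius `ρ : ℂ → ℝ` (`0 < ρ z` for `0 < re z`) with, for every admissible `σ` (`g₁₁·Tr(σδ) ≠ 0`): (G1) regularity on `{0 < re}`, (G2) the twisted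
big-cell integral of `G` on `{1 < re}`, and (G3) `‖GnF σ s (pt x)‖ ≤ (Bnd σ x)^{E z}` for `dist s z < ρ z` — `E`, `ρ` INDEPENDENT OF `σ`.
[cite: KudlaRallis1994, §2] [cite: KudlaSweet1997, §1] [cite: HarrisKudlaSweet1996, §1 (1.15), §6 (6.14)–(6.16)] [cite: Casselman1980, §3 Thm. 3.1] [cite: Shimura1997, §18.1 (18.4)] -/
theorem exists_face_sigmaUniform_of_monomialFlat
    [MeasurableSpace ↥(unipDeltaLoc L e dV hdV dW hdW v)] [BorelSpace ↥(unipDeltaLoc L e dV hdV dW hdW v)] (ν : Measure ↥(unipDeltaLoc L e dV hdV dW hdW v)) [ν.IsHaarMeasure]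
    (χv : ∀ w : PlacesOver L v, (w.1.adicCompletion L)ˣ →* ℂˣ) (hχ : ∀ (w' : PlacesOver L v) (x : (w'.1.adicCompletion L)ˣ), ‖((χv w' x : ℂˣ) : ℂ)‖ = 1)
    (K₀ : Subgroup (UnitaryGroup.localPi L (IsCMField.complexConj L) (2 + 2) (hermD L e dV hdV dW hdW) v))
    (hK₀ : IsCompact (K₀ : Set (UnitaryGroup.localPi L (IsCMField.complexConj L) (2 + 2) (hermD L e dV hdV dW hdW) v)) ∧
      IsOpen (K₀ : Set (UnitaryGroup.localPi L (IsCMField.complexConj L) (2 + 2) (hermD L e dV hdV dW hdW) v)))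
    (hIw : haveI : Algebra.IsQuadraticExtension (Fp L) L := IsCMField.isQuadraticExtension L
      ∀ g : UnitaryGroup.localPi L (IsCMField.complexConj L) (2 + 2) (hermD L e dV hdV dW hdW) v,
        ∃ p, IsSiegelDelta (Fp L) L (IsCMField.complexConj L) (complexConj_imagUnit L) (imagUnit_ne_zero L) (imagUnit_mul_self L)
          v 2 (gramR_isSymm L e dV hdV dW hdW) (hermD_eq_map_gramD L e dV hdV dW hdW) p ∧ ∃ k ∈ K₀, g = p * k)
    (G : ℂ → UnitaryGroup.localPi L (IsCMField.complexConj L) (2 + 2) (hermD L e dV hdV dW hdW) v → ℂ)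
    (hSieg : haveI : Algebra.IsQuadraticExtension (Fp L) L := IsCMField.isQuadraticExtension L
      ∀ s, IsLocalSiegelSection (Fp L) L (IsCMField.complexConj L) (complexConj_imagUnit L) (imagUnit_ne_zero L) (imagUnit_mul_self L)
        v 2 (gramR_isSymm L e dV hdV dW hdW) (hermD_eq_map_gramD L e dV hdV dW hdW) χv s (G s))
    (hsm : ∀ s, IsSmooth (Fp L) L (IsCMField.complexConj L) v 2 (G s))
    (Hf : UnitaryGroup.localPi L (IsCMField.complexConj L) (2 + 2) (hermD L e dV hdV dW hdW) v → ℝ) (hf1 : ∀ u, 0 < Hf u)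
    (hf2 : haveI : Algebra.IsQuadraticExtension (Fp L) L := IsCMField.isQuadraticExtension L
      ∀ p : UnitaryGroup.localPi L (IsCMField.complexConj L) (2 + 2) (hermD L e dV hdV dW hdW) v,
        IsSiegelDelta (Fp L) L (IsCMField.complexConj L) (complexConj_imagUnit L) (imagUnit_ne_zero L) (imagUnit_mul_self L)
          v 2 (gramR_isSymm L e dV hdV dW hdW) (hermD_eq_map_gramD L e dV hdV dW hdW) p → p ∈ K₀ → ∀ u, Hf (p * u) = Hf u)
    (U : OpenSubgroup (UnitaryGroup.localPi L (IsCMField.complexConj L) (2 + 2) (hermD L e dV hdV dW hdW) v))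
    (hf3 : ∀ u k : UnitaryGroup.localPi L (IsCMField.complexConj L) (2 + 2) (hermD L e dV hdV dW hdW) v,
      k ∈ (U : Subgroup (UnitaryGroup.localPi L (IsCMField.complexConj L) (2 + 2) (hermD L e dV hdV dW hdW) v)) → Hf (u * k) = Hf u)
    (hf4 : ∀ u, ∃ k : ℤ, Hf u ^ 2 = (residueFieldCard (v.adicCompletion (Fp L)) : ℝ) ^ k) (s₀ : ℂ)
    (hG : ∀ s u, G s u = ((Hf u : ℝ) : ℂ) ^ (2 * (s - s₀)) * G s₀ u)
    -- the abstract translate currency: points and a base dominating `q_v`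
    {X : Type*} (pt : X → UnitaryGroup.localPi L (IsCMField.complexConj L) (2 + 2) (hermD L e dV hdV dW hdW) v) (Bnd : L → X → ℝ)
    (hBnd : ∀ σ x, ((v.residueCard : ℕ) : ℝ) ≤ Bnd σ x)
    -- (P-bad) AT THIS PLACE AND THIS `K₀`: the witness-free growth letter for every `K₀`-flat family of smooth Siegel sections of weight `χ_v`
    (hgrowth : ∀ F : ℂ → UnitaryGroup.localPi L (IsCMField.complexConj L) (2 + 2) (hermD L e dV hdV dW hdW) v → ℂ,
      (haveI : Algebra.IsQuadraticExtension (Fp L) L := IsCMField.isQuadraticExtension L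
        ∀ s, IsLocalSiegelSection (Fp L) L (IsCMField.complexConj L) (complexConj_imagUnit L) (imagUnit_ne_zero L) (imagUnit_mul_self L)
          v 2 (gramR_isSymm L e dV hdV dW hdW) (hermD_eq_map_gramD L e dV hdV dW hdW) χv s (F s)) →
      (∀ s, IsSmooth (Fp L) L (IsCMField.complexConj L) v 2 (F s)) →
      (∀ s s' : ℂ, ∀ k ∈ K₀, F s k = F s' k) →
      ∀ z : ℂ, 0 < z.re → ∃ (Mb : ℕ) (rb : ℝ), 0 < rb ∧
      ∀ σ : L, gramR L e dV hdV dW hdW 1 1 * Algebra.trace (Fp L) L (σ * imagUnit L) ≠ 0 →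
      ∀ Gn : ℂ → UnitaryGroup.localPi L (IsCMField.complexConj L) (2 + 2) (hermD L e dV hdV dW hdW) v → ℂ,
        (∀ s₁ : ℂ, 0 < s₁.re → ∀ y₀, IsQRationalRegularAt (residueFieldCard (v.adicCompletion (Fp L))) s₁ (fun s => Gn s y₀)) →
        (∀ s : ℂ, 1 < s.re → ∀ y₀ : UnitaryGroup.localPi L (IsCMField.complexConj L) (2 + 2) (hermD L e dV hdV dW hdW) v,
          ∫ y : ↥(unipDeltaLoc L e dV hdV dW hdW v), conj ((unipDeltaChar L e dV hdV dW hdW (Matrix.single 1 1 σ)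
                (locToAdelic L e dV hdV dW hdW v (y : UnitaryGroup.localPi L (IsCMField.complexConj L) (2 + 2) (hermD L e dV hdV dW hdW) v)) : ℂ)) *
              F s (UnitaryGroup.evalPlace (Fp L) L (IsCMField.complexConj L) (2 + 2) (hermD L e dV hdV dW hdW) v
                    (UnitaryGroup.finPart (Fp L) L (IsCMField.complexConj L) (2 + 2) (hermD L e dV hdV dW hdW) (SiegelDoubled.weylDelta L e dV hdV dW hdW)) *
                (y : UnitaryGroup.localPi L (IsCMField.complexConj L) (2 + 2) (hermD L e dV hdV dW hdW) v) * y₀) ∂ν = Gn s y₀) →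
        ∀ s : ℂ, dist s z < rb → ∀ x : X, ‖Gn s (pt x)‖ ≤ Bnd σ x ^ Mb) :
    ∃ (GnF : L → ℂ → UnitaryGroup.localPi L (IsCMField.complexConj L) (2 + 2) (hermD L e dV hdV dW hdW) v → ℂ) (E : ℂ → ℕ) (ρ : ℂ → ℝ),
      (∀ z : ℂ, 0 < z.re → 0 < ρ z) ∧
      (∀ σ : L, gramR L e dV hdV dW hdW 1 1 * Algebra.trace (Fp L) L (σ * imagUnit L) ≠ 0 →
        (∀ s₁ : ℂ, 0 < s₁.re → ∀ y₀, IsQRationalRegularAt (residueFieldCard (v.adicCompletion (Fp L))) s₁ (fun s => GnF σ s y₀)) ∧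
        ∀ s : ℂ, 1 < s.re → ∀ y₀ : UnitaryGroup.localPi L (IsCMField.complexConj L) (2 + 2) (hermD L e dV hdV dW hdW) v,
          ∫ y : ↥(unipDeltaLoc L e dV hdV dW hdW v), conj ((unipDeltaChar L e dV hdV dW hdW (Matrix.single 1 1 σ)
                (locToAdelic L e dV hdV dW hdW v (y : UnitaryGroup.localPi L (IsCMField.complexConj L) (2 + 2) (hermD L e dV hdV dW hdW) v)) : ℂ)) *
              G s (UnitaryGroup.evalPlace (Fp L) L (IsCMField.complexConj L) (2 + 2) (hermD L e dV hdV dW hdW) v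
                    (UnitaryGroup.finPart (Fp L) L (IsCMField.complexConj L) (2 + 2) (hermD L e dV hdV dW hdW) (SiegelDoubled.weylDelta L e dV hdV dW hdW)) *
                (y : UnitaryGroup.localPi L (IsCMField.complexConj L) (2 + 2) (hermD L e dV hdV dW hdW) v) * y₀) ∂ν = GnF σ s y₀) ∧
      ∀ z : ℂ, 0 < z.re → ∀ σ : L, gramR L e dV hdV dW hdW 1 1 * Algebra.trace (Fp L) L (σ * imagUnit L) ≠ 0 →
        ∀ s : ℂ, dist s z < ρ z → ∀ x : X, ‖GnF σ s (pt x)‖ ≤ Bnd σ x ^ E z := by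
  haveI : Algebra.IsQuadraticExtension (Fp L) L := IsCMField.isQuadraticExtension L
  -- ★ FILE B ED.1: the σ-FREE pieces (labels `c > 0` with `c² ∈ q_v^ℤ`, `K₀`-flat smooth Siegel pieces, the pointwise decomposition)
  obtain ⟨Sset, Fc, hL, hSiegc, hsmc, hflatc, hdec⟩ :=
    exists_monomialFlat_pieces L e dV hdV dW hdW v χv K₀ hK₀ hIw G hSieg hsm Hf hf1 hf2 U hf3 hf4 s₀ hG
  -- ★ p863501 per (piece, σ), guarded by the corner letter
  have hface : ∀ (c : ℝ) (σ : L), ∃ Gn : ℂ → UnitaryGroup.localPi L (IsCMField.complexConj L) (2 + 2) (hermD L e dV hdV dW hdW) v → ℂ,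
      gramR L e dV hdV dW hdW 1 1 * Algebra.trace (Fp L) L (σ * imagUnit L) ≠ 0 →
      (∀ s₁ : ℂ, 0 < s₁.re → ∀ y₀, IsQRationalRegularAt (residueFieldCard (v.adicCompletion (Fp L))) s₁ (fun s => Gn s y₀)) ∧
      ∀ s : ℂ, 1 < s.re → ∀ y₀ : UnitaryGroup.localPi L (IsCMField.complexConj L) (2 + 2) (hermD L e dV hdV dW hdW) v,
        ∫ y : ↥(unipDeltaLoc L e dV hdV dW hdW v), conj ((unipDeltaChar L e dV hdV dW hdW (Matrix.single 1 1 σ)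
              (locToAdelic L e dV hdV dW hdW v (y : UnitaryGroup.localPi L (IsCMField.complexConj L) (2 + 2) (hermD L e dV hdV dW hdW) v)) : ℂ)) *
            Fc c s (UnitaryGroup.evalPlace (Fp L) L (IsCMField.complexConj L) (2 + 2) (hermD L e dV hdV dW hdW) v
                  (UnitaryGroup.finPart (Fp L) L (IsCMField.complexConj L) (2 + 2) (hermD L e dV hdV dW hdW) (SiegelDoubled.weylDelta L e dV hdV dW hdW)) *
                (y : UnitaryGroup.localPi L (IsCMField.complexConj L) (2 + 2) (hermD L e dV hdV dW hdW) v) * y₀) ∂ν = Gn s y₀ := by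
    intro c σ
    by_cases hσ : gramR L e dV hdV dW hdW 1 1 * Algebra.trace (Fp L) L (σ * imagUnit L) ≠ 0
    · obtain ⟨Gn, h1, h2⟩ := exists_localFace_kindOneSingular L e dV hdV hdV0 dW hdW hdW0 v ν χv hχ K₀ hK₀ hIw (Fc c) (hSiegc c) (hsmc c) (hflatc c) σ hσ
      exact ⟨Gn, fun _ => ⟨h1, h2⟩⟩
    · exact ⟨fun _ _ => 0, fun h => absurd h hσ⟩
  choose Gn₀ hGn₀ using hface
  -- the growth letter per piece: one exponent ∕ radius per `(c, z)`
  have hgr := fun c : ℝ => hgrowth (Fc c) (hSiegc c) (hsmc c) (hflatc c)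
  choose! Mb rb hrb hbad using hgr
  -- the labels' monomials on the unit disc at `z` (★ FILE B ED.2 §1)
  have hq1 : (1 : ℝ) ≤ (residueFieldCard (v.adicCompletion (Fp L)) : ℝ) := by exact_mod_cast Nat.one_le_iff_ne_zero.2 (residueFieldCard_ne_zero _)
  choose Mℓ hMℓ using fun z : ℂ => exists_uniform_pow_bound hq1 Sset hL z s₀
  -- one radius `≤ 1` below the pieces' radii (§1)
  have hrad : ∀ z : ℂ, ∃ r : ℝ, (0 < z.re → 0 < r) ∧ r ≤ 1 ∧ (0 < z.re → ∀ c ∈ Sset, r ≤ rb c z) := fun z => by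
    by_cases hz : 0 < z.re
    · obtain ⟨r, hr, hr1, hrs⟩ := exists_pos_le_one_forall_le Sset (fun c => rb c z) fun c _ => hrb c z hz
      exact ⟨r, fun _ => hr, hr1, fun _ => hrs⟩
    · exact ⟨1, fun h => absurd h hz, le_rfl, fun h => absurd h hz⟩
  choose ρ hρpos hρ1 hρle using hrad
  refine ⟨fun σ s y₀ => ∑ c ∈ Sset, ((c : ℝ) : ℂ) ^ (2 * (s - s₀)) * Gn₀ c σ s y₀, fun z => Sset.card + (Mℓ z + Sset.sup fun c => Mb c z), ρ, hρpos,
    fun σ hσ => ⟨fun s₁ hs₁ y₀ => ?_, fun s hs y₀ => ?_⟩, fun z hz σ hσ s hs x => ?_⟩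
  · -- (G1): a finite sum of (monomial in `q_v^(−s)`) × (★ p863501's regular letter) — ★ FILE B ED.2's argument
    refine IsQRationalRegularAt.sum Sset fun c hc => IsQRationalRegularAt.mul ?_ ((hGn₀ c σ hσ).1 s₁ hs₁ y₀)
    obtain ⟨hc0, K, hK⟩ := hL c hc
    refine (isQRationalRegularAt_zpow_cpow_add (residueFieldCard_ne_zero _) K (-s₀) s₁).congr fun s => ?_
    rw [← hK, ← sub_eq_add_neg, cpow_two_mul_of_pos hc0]
  · -- (G2): the twisted big-cell integral of `G` = the sum over the pieces (★ FILE B ED.1 `integral_mul_eq_sum` + its integrability lemma)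
    exact integral_mul_eq_sum ν Sset (fun c => ((c : ℝ) : ℂ) ^ (2 * (s - s₀))) (fun c => Gn₀ c σ s y₀)
      (fun y => conj ((unipDeltaChar L e dV hdV dW hdW (Matrix.single 1 1 σ)
              (locToAdelic L e dV hdV dW hdW v (y : UnitaryGroup.localPi L (IsCMField.complexConj L) (2 + 2) (hermD L e dV hdV dW hdW) v)) : ℂ)))
      (fun y => G s (UnitaryGroup.evalPlace (Fp L) L (IsCMField.complexConj L) (2 + 2) (hermD L e dV hdV dW hdW) v
                  (UnitaryGroup.finPart (Fp L) L (IsCMField.complexConj L) (2 + 2) (hermD L e dV hdV dW hdW) (SiegelDoubled.weylDelta L e dV hdV dW hdW)) *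
              (y : UnitaryGroup.localPi L (IsCMField.complexConj L) (2 + 2) (hermD L e dV hdV dW hdW) v) * y₀))
      (fun c y => Fc c s (UnitaryGroup.evalPlace (Fp L) L (IsCMField.complexConj L) (2 + 2) (hermD L e dV hdV dW hdW) v
                  (UnitaryGroup.finPart (Fp L) L (IsCMField.complexConj L) (2 + 2) (hermD L e dV hdV dW hdW) (SiegelDoubled.weylDelta L e dV hdV dW hdW)) *
              (y : UnitaryGroup.localPi L (IsCMField.complexConj L) (2 + 2) (hermD L e dV hdV dW hdW) v) * y₀))
      (fun y => hdec s _) (fun c => integrable_conj_unipDeltaChar_mul L e dV hdV hdV0 dW hdW hdW0 v ν χv hχ hs (hSiegc c s) (hsmc c s) _ y₀)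
      fun c => (hGn₀ c σ hσ).2 s hs y₀
  · -- (G3) GROWTH: labels' monomials `≤ q_v^{Mℓ}`, pieces `≤ Bnd^{Mb c}`, summed against the one base `Bnd ≥ q_v ≥ 2` (§1)
    have hq2 : (2 : ℝ) ≤ ((v.residueCard : ℕ) : ℝ) := by exact_mod_cast Nat.succ_le_of_lt (HeightOneSpectrum.one_lt_residueCard v)
    have hq0 : (0 : ℝ) ≤ ((v.residueCard : ℕ) : ℝ) := zero_le_two.trans hq2
    have hB2 : (2 : ℝ) ≤ Bnd σ x := hq2.trans (hBnd σ x)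
    have hB1 : (1 : ℝ) ≤ Bnd σ x := one_le_two.trans hB2
    have hqq : ((residueFieldCard (v.adicCompletion (Fp L)) : ℕ) : ℝ) = ((v.residueCard : ℕ) : ℝ) := by rw [residueFieldCard_adicCompletion_eq (Fp L) v]
    have hterm : ∀ c ∈ Sset, ‖((c : ℝ) : ℂ) ^ (2 * (s - s₀))‖ * ‖Gn₀ c σ s (pt x)‖ ≤ Bnd σ x ^ (Mℓ z + Sset.sup fun c => Mb c z) := by
      intro c hc
      rw [norm_cpow_two_mul (hL c hc).1]
      have h1 : c ^ (2 * (s - s₀).re) ≤ ((v.residueCard : ℕ) : ℝ) ^ Mℓ z := by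
        have := hMℓ z s (lt_of_lt_of_le hs (hρ1 z)) c hc
        rwa [hqq] at this
      calc c ^ (2 * (s - s₀).re) * ‖Gn₀ c σ s (pt x)‖ ≤ ((v.residueCard : ℕ) : ℝ) ^ Mℓ z * Bnd σ x ^ Mb c z :=
            mul_le_mul h1 (hbad c z hz σ hσ (Gn₀ c σ) (hGn₀ c σ hσ).1 (hGn₀ c σ hσ).2 s (lt_of_lt_of_le hs (hρle z hz c hc)) x) (norm_nonneg _) (pow_nonneg hq0 _)
        _ ≤ Bnd σ x ^ (Mℓ z + Mb c z) := pow_mul_pow_le_pow_add hq0 (hBnd σ x) _ _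
        _ ≤ Bnd σ x ^ (Mℓ z + Sset.sup fun c => Mb c z) := pow_le_pow_right₀ hB1 (Nat.add_le_add_left (Finset.le_sup (f := fun c => Mb c z) hc) _)
    exact (norm_sum_mul_le Sset _ _).trans (sum_le_pow_card_add Sset hB2 _ _ hterm)

end CM

end Summit.HodgeConjecture.HodgeConjecture.Cruxes.HLiu418.K2LiuKindOneSingularLocalFaceSigmaUniform
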